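import Summits.ResolutionOfSingularities.ResolutionOfSingularities.Theorems.FrobeniusLadderFRationalResolutionPointCentreBlowupRegular
import HarnessLib

/-!
# Crux `FrobeniusLadder.FRationalResolution` (stmt-ResolutionOfSingularities-15317), line `redirect`,
# stub `stub_diagonalizableQuotientResolution` — THE NAIVE INTRINSIC RECIPE «BLOW UP A POWER OF THE MAXIMAL IDEAL, THEN THE SINGULAR
# POINTS» SETTLES THE TWISTED POINT, with NO cover, cocycle or class-group input (print-free user-facing corollaries of p838347 +
# `…CharacteristicTower` + `…PointCentreBlowupRegular`, this generation)

Powers of the maximal ideal of a local ring are CHARACTERISTIC for free (every ring automorphism of a local ring preserves the maximal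
ideal). So the one-ideal interface `…GaloisCharacteristicCentre.hloc_of_characteristic_ideal_adicCompletion` (p838347) yields, for a
twisted isolated singular point `x` of the Galois route with complete local ring `Ê = ((B ⊗_K K')_{𝔔'})^` upstairs:

* `map_maximalIdeal_le_of_ringEquiv`, `forall_map_pow_maximalIdeal_le` — `θ(𝔪ᵃ) ⊆ 𝔪ᵃ` for every ring automorphism `θ` of a local ring;
* ★ `hloc_of_isRegular_affineBlowup_maximalIdealPow` — **VERTEX CLASSES**: if `Bl_{𝔪̂ᵃ}(Spec Ê)` is regular for some `a ≥ 1` (cones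
  over projectively normal smooth varieties, e.g. the Veronese cones `𝔸ⁿ/μ_r` of weights `(1,…,1)`), `hloc` holds at `x`;
* ★★ `hloc_of_maximalIdealPow_then_singularPoints` — **TWO NAIVE STEPS**: if `X₁ = Bl_{𝔪̂ᵃ}(Spec Ê)` has a CLOSED singular locus
  consisting of closed points over `V(𝔪̂)`, each of which is resolved by blowing up its maximal ideal (e.g. ordinary double points
  `xy = zw`), then `hloc` holds at `x` (`…PointCentreBlowupRegular.exists_characteristic_ideal_isRegular_of_singularPoints` ∘ p838347).

Longer naive towers go through `…CharacteristicTowerIterate.exists_characteristic_ideal_isRegular_of_itower` in the same way. Honest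
label: plumbing toward ONE leaf stub (no stub, crux or summit closed); which toric classes `1/r(a,b,c)` the naive recipe actually
resolves is a fan computation not done here (MEMO-15317-leafhand2-g16 §2 records that `𝔪`-adic centres «leave the isolated regime» in
general — the class-group centre `𝔞_tot` is the intended first step; these corollaries cover the cases where the naive one suffices).
No definitions, no named facts, no sorry. [cite: StacksProject, Tag 080B; Tag 0CDQ; Tag 09EB] [cite: Matsumura1987, Thm. 8.11; Thm. 8.14]
-/

noncomputable section

-- single-problem summit: the doubled namespace component is forced
set_option linter.dupNamespace false

open CategoryTheory CategoryTheory.Limits AlgebraicGeometry TopologicalSpace TensorProduct IsLocalRing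
open Literature.AlgebraicGeometry.Resolution
open Summit.ResolutionOfSingularities.ResolutionOfSingularities.Theorems.FRationalResolution

namespace Summit.ResolutionOfSingularities.ResolutionOfSingularities.Theorems.FRationalResolution.MaximalIdealTower

/-! ## §1 Powers of the maximal ideal are characteristic -/

/-- A ring automorphism of a local ring maps the maximal ideal into itself (it preserves non-units). [folklore] -/
theorem map_maximalIdeal_le_of_ringEquiv {R : Type} [CommRing R] [IsLocalRing R] (θ : R ≃+* R) :
    (maximalIdeal R).map (θ : R →+* R) ≤ maximalIdeal R := by
  rw [Ideal.map_le_iff_le_comap]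
  intro x hx
  rw [Ideal.mem_comap, mem_maximalIdeal, mem_nonunits_iff]
  intro hu
  rw [mem_maximalIdeal, mem_nonunits_iff] at hx
  exact hx (by simpa using hu.map (θ.symm : R →+* R))

/-- Hence every power `𝔪ᵃ` is characteristic. [folklore] -/
theorem forall_map_pow_maximalIdeal_le {R : Type} [CommRing R] [IsLocalRing R] (a : ℕ) :
    ∀ θ : R ≃+* R, (maximalIdeal R ^ a).map (θ : R →+* R) ≤ maximalIdeal R ^ a := by
  intro θ
  rw [Ideal.map_pow]
  exact Ideal.pow_right_mono (map_maximalIdeal_le_of_ringEquiv θ) a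

/-! ## §2 Vertex classes: one blow-up of a power of the maximal ideal -/

/-- ★ **VERTEX CLASSES.** Data as in `…GaloisCharacteristicCentre.hloc_of_characteristic_ideal_adicCompletion`; if `Bl_{(𝔔'Ê)ᵃ⁺¹}(Spec Ê)`
is regular then `hloc` holds at the twisted point — no stability hypothesis is left, powers of the maximal ideal being characteristic.
[cite: StacksProject, Tag 0CDQ; Tag 09EB] [cite: Matsumura1987, Thm. 8.11; Thm. 8.14] -/
theorem hloc_of_isRegular_affineBlowup_maximalIdealPow (K : Type) [Field K] (X : Scheme.{0}) [IsIntegral X]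
    (f : X ⟶ Spec (.of K)) [LocallyOfFiniteType f]
    {B : Type} [CommRing B] [IsDomain B] [Algebra K B] [Algebra.FiniteType K B]
    (ι : Spec (.of B) ⟶ X) [IsOpenImmersion ι] (hι : ι ≫ f = Spec.map (CommRingCat.ofHom (algebraMap K B)))
    (𝔭 : Ideal B) [h𝔭 : 𝔭.IsMaximal] (h𝔭0 : 𝔭 ≠ ⊥)
    (hsing : ι ⟨𝔭, h𝔭.isPrime⟩ ∉ Scheme.regularLocus X)
    (hregB : ∀ P : Spec (.of B), P.asIdeal ≠ 𝔭 → P ∈ Scheme.regularLocus (Spec (.of B)))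
    (K' : Type) [Field K'] [Algebra K K'] [FiniteDimensional K K'] [IsGalois K K']
    (𝔔' : Ideal (B ⊗[K] K')) [h𝔔' : 𝔔'.IsMaximal] (h𝔔'𝔭 : 𝔔'.comap (algebraMap B (B ⊗[K] K')) = 𝔭) (a : ℕ)
    (hreg : Scheme.IsRegular (affineBlowup ((𝔔'.map (algebraMap (B ⊗[K] K')
      (AdicCompletion (maximalIdeal (Localization.AtPrime 𝔔')) (Localization.AtPrime 𝔔')))) ^ (a + 1)))) :
    ∃ (V : X.Opens), ι ⟨𝔭, h𝔭.isPrime⟩ ∈ V ∧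
      (∀ t : X, t ∉ Scheme.regularLocus X → t ∈ V → t = ι ⟨𝔭, h𝔭.isPrime⟩) ∧
      ∃ (Y : Scheme.{0}) (ρ : Y ⟶ V), IsProper ρ ∧ Scheme.IsRegular Y ∧
        IsIso (ρ ∣_ (V.ι ⁻¹ᵁ ⟨Scheme.regularLocus X, isOpen_regularLocus_of_locallyOfFiniteType_field f⟩)) ∧
        Dense ((ρ ⁻¹ᵁ (V.ι ⁻¹ᵁ ⟨Scheme.regularLocus X,
          isOpen_regularLocus_of_locallyOfFiniteType_field f⟩) : Y.Opens) : Set Y) := by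
  haveI : IsNoetherianRing B := Algebra.FiniteType.isNoetherianRing K B
  haveI : Algebra.FiniteType B (B ⊗[K] K') := inferInstance
  haveI : IsNoetherianRing (B ⊗[K] K') := Algebra.FiniteType.isNoetherianRing B (B ⊗[K] K')
  haveI : IsNoetherianRing (Localization.AtPrime 𝔔') :=
    IsLocalization.isNoetherianRing 𝔔'.primeCompl (Localization.AtPrime 𝔔') inferInstance
  set Ê := AdicCompletion (maximalIdeal (Localization.AtPrime 𝔔')) (Localization.AtPrime 𝔔') with hÊ
  have hfac : algebraMap (B ⊗[K] K') Ê = (algebraMap (Localization.AtPrime 𝔔') Ê).comp (algebraMap (B ⊗[K] K') (Localization.AtPrime 𝔔')) :=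
    RingHom.ext fun _ => rfl
  have hmapQ : 𝔔'.map (algebraMap (B ⊗[K] K') Ê) = maximalIdeal Ê := by
    rw [hfac, ← Ideal.map_map, Localization.AtPrime.map_eq_maximalIdeal, ← AdicCompletion.maximalIdeal_eq_map]
  refine GaloisCharacteristicCentre.hloc_of_characteristic_ideal_adicCompletion K X f ι hι 𝔭 h𝔭0 hsing hregB K' 𝔔' h𝔔'𝔭
    ((𝔔'.map (algebraMap (B ⊗[K] K') Ê)) ^ (a + 1)) le_rfl ?_ (fun θ => ?_) hreg
  · rw [hmapQ]
    exact (Ideal.pow_le_self (Nat.succ_ne_zero a)).trans_lt (lt_top_iff_ne_top.mpr (maximalIdeal.isMaximal Ê).ne_top) |>.ne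
  · rw [hmapQ]
    exact forall_map_pow_maximalIdeal_le (a + 1) θ

/-! ## §3 Two naive steps: a power of the maximal ideal, then the singular points -/

/-- ★★ **TWO NAIVE INTRINSIC STEPS SETTLE THE TWISTED POINT.** Data as in p838347; let `X₁ = Bl_{(𝔔'Ê)ᵃ⁺¹}(Spec Ê)`. If the singular
locus of `X₁` is closed, consists of closed points lying over `V(𝔔'Ê)`, and `Bl_{𝔪_z}(Spec 𝒪_{X₁,z})` is regular for each singular `z`,
then `hloc` holds at the twisted point. [cite: StacksProject, Tag 080B; Tag 0CDQ; Tag 09EB] [cite: Matsumura1987, Thm. 8.11; Thm. 8.14] -/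
theorem hloc_of_maximalIdealPow_then_singularPoints (K : Type) [Field K] (X : Scheme.{0}) [IsIntegral X]
    (f : X ⟶ Spec (.of K)) [LocallyOfFiniteType f]
    {B : Type} [CommRing B] [IsDomain B] [Algebra K B] [Algebra.FiniteType K B]
    (ι : Spec (.of B) ⟶ X) [IsOpenImmersion ι] (hι : ι ≫ f = Spec.map (CommRingCat.ofHom (algebraMap K B)))
    (𝔭 : Ideal B) [h𝔭 : 𝔭.IsMaximal] (h𝔭0 : 𝔭 ≠ ⊥)
    (hsing : ι ⟨𝔭, h𝔭.isPrime⟩ ∉ Scheme.regularLocus X)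
    (hregB : ∀ P : Spec (.of B), P.asIdeal ≠ 𝔭 → P ∈ Scheme.regularLocus (Spec (.of B)))
    (K' : Type) [Field K'] [Algebra K K'] [FiniteDimensional K K'] [IsGalois K K']
    (𝔔' : Ideal (B ⊗[K] K')) [h𝔔' : 𝔔'.IsMaximal] (h𝔔'𝔭 : 𝔔'.comap (algebraMap B (B ⊗[K] K')) = 𝔭) (a : ℕ)
    (hZc : IsClosed (Scheme.regularLocus (affineBlowup ((𝔔'.map (algebraMap (B ⊗[K] K')
      (AdicCompletion (maximalIdeal (Localization.AtPrime 𝔔')) (Localization.AtPrime 𝔔')))) ^ (a + 1))))ᶜ)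
    (hpt : ∀ z ∈ (Scheme.regularLocus (affineBlowup ((𝔔'.map (algebraMap (B ⊗[K] K')
      (AdicCompletion (maximalIdeal (Localization.AtPrime 𝔔')) (Localization.AtPrime 𝔔')))) ^ (a + 1))))ᶜ,
      IsClosed ({z} : Set _))
    (hZ𝔪 : ∀ z ∈ (Scheme.regularLocus (affineBlowup ((𝔔'.map (algebraMap (B ⊗[K] K')
      (AdicCompletion (maximalIdeal (Localization.AtPrime 𝔔')) (Localization.AtPrime 𝔔')))) ^ (a + 1))))ᶜ,
      𝔔'.map (algebraMap (B ⊗[K] K')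
        (AdicCompletion (maximalIdeal (Localization.AtPrime 𝔔')) (Localization.AtPrime 𝔔'))) ≤ (affineBlowup.π _ z).asIdeal)
    (hloc : ∀ z ∈ (Scheme.regularLocus (affineBlowup ((𝔔'.map (algebraMap (B ⊗[K] K')
      (AdicCompletion (maximalIdeal (Localization.AtPrime 𝔔')) (Localization.AtPrime 𝔔')))) ^ (a + 1))))ᶜ,
      Scheme.IsRegular (affineBlowup (maximalIdeal ((affineBlowup ((𝔔'.map (algebraMap (B ⊗[K] K')
        (AdicCompletion (maximalIdeal (Localization.AtPrime 𝔔')) (Localization.AtPrime 𝔔')))) ^ (a + 1))).presheaf.stalk z)))) :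
    ∃ (V : X.Opens), ι ⟨𝔭, h𝔭.isPrime⟩ ∈ V ∧
      (∀ t : X, t ∉ Scheme.regularLocus X → t ∈ V → t = ι ⟨𝔭, h𝔭.isPrime⟩) ∧
      ∃ (Y : Scheme.{0}) (ρ : Y ⟶ V), IsProper ρ ∧ Scheme.IsRegular Y ∧
        IsIso (ρ ∣_ (V.ι ⁻¹ᵁ ⟨Scheme.regularLocus X, isOpen_regularLocus_of_locallyOfFiniteType_field f⟩)) ∧
        Dense ((ρ ⁻¹ᵁ (V.ι ⁻¹ᵁ ⟨Scheme.regularLocus X,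
          isOpen_regularLocus_of_locallyOfFiniteType_field f⟩) : Y.Opens) : Set Y) := by
  haveI : IsNoetherianRing B := Algebra.FiniteType.isNoetherianRing K B
  haveI : Algebra.FiniteType B (B ⊗[K] K') := inferInstance
  haveI : IsNoetherianRing (B ⊗[K] K') := Algebra.FiniteType.isNoetherianRing B (B ⊗[K] K')
  haveI : IsNoetherianRing (Localization.AtPrime 𝔔') :=
    IsLocalization.isNoetherianRing 𝔔'.primeCompl (Localization.AtPrime 𝔔') inferInstance
  set Ê := AdicCompletion (maximalIdeal (Localization.AtPrime 𝔔')) (Localization.AtPrime 𝔔') with hÊ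
  haveI : IsNoetherianRing Ê := isNoetherianRing_adicCompletion_maximalIdeal _
  have hfac : algebraMap (B ⊗[K] K') Ê = (algebraMap (Localization.AtPrime 𝔔') Ê).comp (algebraMap (B ⊗[K] K') (Localization.AtPrime 𝔔')) :=
    RingHom.ext fun _ => rfl
  have hmapQ : 𝔔'.map (algebraMap (B ⊗[K] K') Ê) = maximalIdeal Ê := by
    rw [hfac, ← Ideal.map_map, Localization.AtPrime.map_eq_maximalIdeal, ← AdicCompletion.maximalIdeal_eq_map]
  set 𝔪 := 𝔔'.map (algebraMap (B ⊗[K] K') Ê) with h𝔪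
  have htop : 𝔪 ^ (a + 1) ≠ ⊤ := by
    rw [hmapQ]
    exact (Ideal.pow_le_self (Nat.succ_ne_zero a)).trans_lt (lt_top_iff_ne_top.mpr (maximalIdeal.isMaximal Ê).ne_top) |>.ne
  have hchar : ∀ θ : Ê ≃+* Ê, (𝔪 ^ (a + 1)).map (θ : Ê →+* Ê) ≤ 𝔪 ^ (a + 1) := by
    rw [hmapQ]
    exact forall_map_pow_maximalIdeal_le (a + 1)
  obtain ⟨J₂, c, hchar₂, hc, hJ₂top, hreg₂⟩ :=
    PointCentreBlowupRegular.exists_characteristic_ideal_isRegular_of_singularPoints 𝔪 (𝔪 ^ (a + 1)) le_rfl htop hchar hZc hpt hZ𝔪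
      hloc
  exact GaloisCharacteristicCentre.hloc_of_characteristic_ideal_adicCompletion K X f ι hι 𝔭 h𝔭0 hsing hregB K' 𝔔' h𝔔'𝔭 J₂ hc
    hJ₂top (fun θ => hchar₂ θ) hreg₂

end Summit.ResolutionOfSingularities.ResolutionOfSingularities.Theorems.FRationalResolution.MaximalIdealTower

end
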